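import Summits.CriticalPhenomena.CardyFormulaZ2.Theorems.CardyUniqueLimitCardyRigidityLevelExtension
import Summits.CriticalPhenomena.CardyFormulaZ2.Theorems.CardyUniqueLimitCardyRigidityFarFieldMeasurable
import Literature.Probability.Process.StoppedClockContinuity
import Literature.Probability.RandomPlanarGeometry.LoewnerRealFlowDriverContinuity
import Literature.Probability.Process.PathSpaceBorel
import Literature.Probability.RandomPlanarGeometry.ObservableDiscretePassageAE
import Literature.Probability.Process.NaturalFiltrationMartingale
import Literature.Probability.Process.ExitTimeCleanLevels
import Literature.Probability.RandomPlanarGeometry.LoewnerRealFlowGapAntitone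

/-!
# The level-stopped crossing observable as a functional on driving-path space (line `crossing-martingale`, crux `CardyRigidity`)

Path-space half of the PASSAGE of the crossing-martingale property to a scaling limit (stub
`stub_crossingMartingale` of crux `CardyRigidity`, stmt-CriticalPhenomena-0746; vocabulary of
`Theorems/CardyUniqueLimitCardyRigidityDefs.lean`).  On the path space `C([0, ∞), ℝ)` (compact-open
topology) consider the RECENTRED canonical driving process `drv p t = p t - p 0` (so that every path
starts at `0` and the pathwise lemmas of the `Defs` module apply to all of path space), and for
admissible data `(x; m, M, d)` and a kernel `ĝ` the functional
`N_u(p) = crossingObs ĝ drv x m M d u p` — the kernel of the modulus of the three mark flows of the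
path at the clock `u ∧ levelTime`.  Results:

* `measurable_crossingObs_path` — `N_u` is Borel measurable for continuous `ĝ` (adaptedness of the
  stopped modulus, `FarField.measurable_etaProc_stopped`, in the natural filtration of `drv`);
* `continuous_crossingObs_time` — `u ↦ N_u(p)` is continuous for every path and continuous `ĝ`;
* `exists_clamp_kernel` — a kernel `g` merely continuous on `(0,1)` may be replaced by a continuous
  bounded `ĝ` agreeing with it on every stopped modulus of every inner level (all stopped moduli
  live in one compact subset of `(0,1)`);
* `continuousAt_markFlow_path` — the mark flows `(s, p) ↦ markFlow drv y s p` are jointly continuous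
  at `(s, p₀)` as long as the flow of `p₀` stays away from the driving point
  (`Loewner.continuousAt_realFlowStop_driver`);
* `continuousAt_crossingObs_path` — **the a.e.-continuity input of the passage theorem**: if every
  coordinate of the level box attaining the level time of `p₀` exits cleanly, then
  `(u, p) ↦ N_u(p)` is jointly continuous at `(u₀, p₀)` for every `u₀`
  (`Process.continuousAt_stoppedClock_of_lsc_usc(_of_lt)` for the level time = minimum of the three
  exit times).
-/

noncomputable section

open MeasureTheory Filter Set Topology Metric
open scoped NNReal ENNReal
open Literature.Probability.RandomPlanarGeometry
open Literature.Probability.Process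

namespace Summit.CriticalPhenomena.CardyFormulaZ2.Cruxes.CardyRigidity.CrossingMartingale

namespace Passage

/-- The recentred canonical driving process on path space. -/
local notation "drv" => (fun (p : C(ℝ≥0, ℝ)) (t : ℝ≥0) ↦ p t - p 0)

variable {x : Fin 3 → ℝ} {m M d : ℝ}

/-! ### The recentred canonical process -/

/-- Paths of `drv` are continuous. [folklore] -/
theorem drv_continuous : ∀ p : C(ℝ≥0, ℝ), Continuous (drv p) := fun p ↦
  p.continuous.sub continuous_const

/-- Paths of `drv` start at `0`. [folklore] -/
theorem drv_zero : ∀ p : C(ℝ≥0, ℝ), drv p 0 = 0 := fun p ↦ sub_self (p 0)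

section Measurable

variable [MeasurableSpace C(ℝ≥0, ℝ)] [BorelSpace C(ℝ≥0, ℝ)]

/-- The coordinates of `drv` are strongly measurable (continuous evaluations). [folklore] -/
theorem stronglyMeasurable_drv (t : ℝ≥0) : StronglyMeasurable fun p : C(ℝ≥0, ℝ) ↦ drv p t :=
  ((continuous_eval_const t).sub (continuous_eval_const (0 : ℝ≥0))).measurable.stronglyMeasurable

/-- **The level-stopped crossing functional is Borel measurable on path space** (continuous
kernel, admissible data). [folklore] -/
theorem measurable_crossingObs_path {ĝ : ℝ → ℝ} (hĝ : Continuous ĝ) (h : AdmissibleLevels x m M d)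
    (u : ℝ≥0) : Measurable fun p : C(ℝ≥0, ℝ) ↦ crossingObs ĝ drv x m M d u p := by
  have hWad : StronglyAdapted (Filtration.natural (fun t (p : C(ℝ≥0, ℝ)) ↦ drv p t)
      stronglyMeasurable_drv) (fun t (p : C(ℝ≥0, ℝ)) ↦ drv p t) :=
    Filtration.stronglyAdapted_natural _
  have hη := FarField.measurable_etaProc_stopped (W := drv) hWad drv_continuous drv_zero h u
  exact hĝ.measurable.comp hη

end Measurable

/-! ### Continuity in time along every path -/

/-- The mark flows of `drv` are continuous in time (positive marks). [folklore] -/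
theorem continuous_markFlow_drv {y : ℝ} (hy : 0 < y) (p : C(ℝ≥0, ℝ)) :
    Continuous fun s ↦ markFlow drv y s p :=
  FarField.continuous_markFlow (W := drv) drv_continuous drv_zero hy p

/-- **The level-stopped crossing functional is continuous in time along every path**
(continuous kernel, admissible data). [folklore] -/
theorem continuous_crossingObs_time {ĝ : ℝ → ℝ} (hĝ : Continuous ĝ) (h : AdmissibleLevels x m M d)
    (p : C(ℝ≥0, ℝ)) : Continuous fun u : ℝ≥0 ↦ crossingObs ĝ drv x m M d u p := by
  have hxpos : ∀ i, 0 < x i := fun i ↦ h.pos.trans_le (h.strictMono.monotone (Fin.zero_le i))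
  set ρ := levelTime drv x m M d p with hρ
  have hclock : Continuous fun u : ℝ≥0 ↦ (min (u : WithTop ℝ≥0) ρ).untopA :=
    continuous_untopA_min_coe ρ
  have hX : ∀ i, Continuous fun u : ℝ≥0 ↦ markFlow drv (x i) (min (u : WithTop ℝ≥0) ρ).untopA p :=
    fun i ↦ (continuous_markFlow_drv (hxpos i) p).comp hclock
  -- denominators never vanish at a stopped clock
  have hden : ∀ u : ℝ≥0, markFlow drv (x 1) (min (u : WithTop ℝ≥0) ρ).untopA p *
      (markFlow drv (x 2) (min (u : WithTop ℝ≥0) ρ).untopA p -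
        markFlow drv (x 0) (min (u : WithTop ℝ≥0) ρ).untopA p) ≠ 0 := by
    intro u
    obtain ⟨hX0, hg1, hg2⟩ := LevelExtension.marks_mem_box (W := drv) drv_continuous drv_zero h p
      (coe_untopA_min_le u ρ)
    have h1 : 0 < markFlow drv (x 1) (min (u : WithTop ℝ≥0) ρ).untopA p := by
      linarith [hX0.1, hg1.1, h.m_pos, h.d_pos]
    have h2 : 0 < markFlow drv (x 2) (min (u : WithTop ℝ≥0) ρ).untopA p -
        markFlow drv (x 0) (min (u : WithTop ℝ≥0) ρ).untopA p := by
      linarith [hg1.1, hg2.1, h.d_pos]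
    positivity
  have hη : Continuous fun u : ℝ≥0 ↦ etaProc drv x (min (u : WithTop ℝ≥0) ρ).untopA p := by
    simp only [etaProc, cardyEta]
    exact ((hX 0).mul ((hX 2).sub (hX 1))).div ((hX 1).mul ((hX 2).sub (hX 0))) hden
  exact hĝ.comp hη

/-! ### A bounded continuous kernel agreeing with `g` on all stopped moduli -/

/-- **Clamping the kernel.**  For `g` continuous on `(0,1)` and admissible `(x; m, M, d)` there is a
continuous bounded `ĝ : ℝ → ℝ` agreeing with `g` on a compact interval `[k₁, k₂] ⊂ (0,1)` which
contains the modulus `cardyEta a (a+g₁) (a+g₁+g₂)` of every point `(a, g₁, g₂)` of the level box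
`[m, M] × [d, G] × [d, G]`, `G = x₂ - x₀ + 1` (so, by `LevelExtension.marks_mem_box`, every stopped
modulus of every inner level, `crossingObs_eq_of_clamp`). [folklore] -/
theorem exists_clamp_kernel {g : ℝ → ℝ} (hg : ContinuousOn g (Ioo 0 1)) (h : AdmissibleLevels x m M d) :
    ∃ ĝ : ℝ → ℝ, Continuous ĝ ∧ (∃ B : ℝ, ∀ y, |ĝ y| ≤ B) ∧ ∃ k₁ k₂ : ℝ, EqOn ĝ g (Icc k₁ k₂) ∧
      ∀ a g₁ g₂ : ℝ, a ∈ Icc m M → g₁ ∈ Icc d (x 2 - x 0 + 1) → g₂ ∈ Icc d (x 2 - x 0 + 1) →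
        cardyEta a (a + g₁) (a + g₁ + g₂) ∈ Icc k₁ k₂ := by
  set G : ℝ := x 2 - x 0 + 1 with hG
  set Φ : ℝ × ℝ × ℝ → ℝ := fun p ↦ cardyEta p.1 (p.1 + p.2.1) (p.1 + p.2.1 + p.2.2) with hΦ
  set box : Set (ℝ × ℝ × ℝ) := Icc m M ×ˢ Icc d G ×ˢ Icc d G with hbox
  have hpos : ∀ p ∈ box, 0 < p.1 ∧ 0 < p.2.1 ∧ 0 < p.2.2 := by
    rintro p ⟨hp0, hp1, hp2⟩
    exact ⟨h.m_pos.trans_le hp0.1, h.d_pos.trans_le hp1.1, h.d_pos.trans_le hp2.1⟩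
  have hΦc : ContinuousOn Φ box := by
    intro p hp
    obtain ⟨h1, h2, h3⟩ := hpos p hp
    refine ContinuousAt.continuousWithinAt ?_
    have hden : (p.1 + p.2.1) * (p.1 + p.2.1 + p.2.2 - p.1) ≠ 0 := by
      have hA : 0 < p.1 + p.2.1 := by linarith
      have hB : 0 < p.1 + p.2.1 + p.2.2 - p.1 := by linarith
      exact (mul_pos hA hB).ne'
    simp only [hΦ, cardyEta]
    refine ContinuousAt.div ?_ ?_ hden
    · exact continuousAt_fst.mul
        ((continuousAt_fst.add (continuousAt_fst.comp continuousAt_snd)).add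
          (continuousAt_snd.comp continuousAt_snd) |>.sub
          (continuousAt_fst.add (continuousAt_fst.comp continuousAt_snd)))
    · exact (continuousAt_fst.add (continuousAt_fst.comp continuousAt_snd)).mul
        (((continuousAt_fst.add (continuousAt_fst.comp continuousAt_snd)).add
          (continuousAt_snd.comp continuousAt_snd)).sub continuousAt_fst)
  have hΦmem : ∀ p ∈ box, Φ p ∈ Ioo (0 : ℝ) 1 := by
    intro p hp
    obtain ⟨h1, h2, h3⟩ := hpos p hp
    exact cardyEta_mem_Ioo h1 (by linarith) (by linarith)
  set K : Set ℝ := Φ '' box with hK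
  have hKc : IsCompact K :=
    (isCompact_Icc.prod (isCompact_Icc.prod isCompact_Icc)).image_of_continuousOn hΦc
  have hKsub : K ⊆ Ioo 0 1 := by
    rintro _ ⟨p, hp, rfl⟩; exact hΦmem p hp
  -- the modulus of the data itself lies in `K`
  have hx01 : x 0 < x 1 := h.strictMono (by decide)
  have hx12 : x 1 < x 2 := h.strictMono (by decide)
  have hKne : K.Nonempty := ⟨Φ (x 0, x 1 - x 0, x 2 - x 1), (x 0, x 1 - x 0, x 2 - x 1),
    ⟨⟨h.m_lt.le, h.lt_M.le⟩, ⟨h.d_lt₁.le, by rw [hG]; linarith⟩, ⟨h.d_lt₂.le, by rw [hG]; linarith⟩⟩,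
    rfl⟩
  obtain ⟨k₁, hk₁K, hk₁⟩ := hKc.exists_isLeast hKne
  obtain ⟨k₂, hk₂K, hk₂⟩ := hKc.exists_isGreatest hKne
  have hk₁pos : 0 < k₁ := (hKsub hk₁K).1
  have hk₂lt : k₂ < 1 := (hKsub hk₂K).2
  have hk₁₂ : k₁ ≤ k₂ := hk₁ hk₂K
  -- the clamp and the clamped kernel
  set cl : ℝ → ℝ := fun y ↦ max k₁ (min y k₂) with hcl
  have hclc : Continuous cl := continuous_const.max (continuous_id.min continuous_const)
  have hclmem : ∀ y, cl y ∈ Icc k₁ k₂ := fun y ↦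
    ⟨le_max_left _ _, max_le hk₁₂ (min_le_right _ _)⟩
  have hclIoo : ∀ y, cl y ∈ Ioo (0 : ℝ) 1 := fun y ↦
    ⟨hk₁pos.trans_le (hclmem y).1, (hclmem y).2.trans_lt hk₂lt⟩
  have hclI : ∀ y ∈ Icc k₁ k₂, cl y = y := fun y hy ↦ by
    rw [hcl]
    simp only
    rw [min_eq_left hy.2, max_eq_right hy.1]
  refine ⟨g ∘ cl, hg.comp_continuous hclc hclIoo, ?_, k₁, k₂, fun y hy ↦ ?_, fun a g₁ g₂ ha hg₁ hg₂ ↦ ?_⟩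
  · -- boundedness: `g` is bounded on the compact `[k₁, k₂] ⊂ (0,1)`
    obtain ⟨B, hB⟩ := (isCompact_Icc (a := k₁) (b := k₂)).exists_bound_of_continuousOn
      (hg.mono fun y hy ↦ ⟨hk₁pos.trans_le hy.1, hy.2.trans_lt hk₂lt⟩)
    refine ⟨B, fun y ↦ ?_⟩
    have := hB (cl y) (hclmem y)
    rwa [Real.norm_eq_abs] at this
  · show g (cl y) = g y
    rw [hclI y hy]
  · have hmem : Φ (a, g₁, g₂) ∈ K := ⟨(a, g₁, g₂), ⟨ha, hg₁, hg₂⟩, rfl⟩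
    exact ⟨hk₁ hmem, hk₂ hmem⟩

/-- **The clamped kernel gives the same level-stopped crossing observables** at every admissible
inner level, for every driving process with continuous paths from `0`. [folklore] -/
theorem crossingObs_eq_of_clamp {g ĝ : ℝ → ℝ} {k₁ k₂ : ℝ} (heq : EqOn ĝ g (Icc k₁ k₂))
    (hbox : ∀ a g₁ g₂ : ℝ, a ∈ Icc m M → g₁ ∈ Icc d (x 2 - x 0 + 1) → g₂ ∈ Icc d (x 2 - x 0 + 1) →
      cardyEta a (a + g₁) (a + g₁ + g₂) ∈ Icc k₁ k₂)
    {Ω : Type*} (W : Ω → ℝ≥0 → ℝ) (hWc : ∀ ω, Continuous (W ω)) (hW0 : ∀ ω, W ω 0 = 0)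
    {m' M' d' : ℝ} (hm' : m ≤ m') (hM' : M' ≤ M) (hd' : d ≤ d') (h' : AdmissibleLevels x m' M' d')
    (t : ℝ≥0) (ω : Ω) : crossingObs ĝ W x m' M' d' t ω = crossingObs g W x m' M' d' t ω := by
  set τ : ℝ≥0 := (min (t : WithTop ℝ≥0) (levelTime W x m' M' d' ω)).untopA with hτdef
  have hτρ : (τ : WithTop ℝ≥0) ≤ levelTime W x m' M' d' ω := coe_untopA_min_le t _
  obtain ⟨hX0, hg1, hg2⟩ := LevelExtension.marks_mem_box hWc hW0 h' ω hτρ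
  have hη : etaProc W x τ ω = cardyEta (markFlow W (x 0) τ ω)
      (markFlow W (x 0) τ ω + (markFlow W (x 1) τ ω - markFlow W (x 0) τ ω))
      (markFlow W (x 0) τ ω + (markFlow W (x 1) τ ω - markFlow W (x 0) τ ω) +
        (markFlow W (x 2) τ ω - markFlow W (x 1) τ ω)) := by
    simp only [etaProc]
    congr 1 <;> ring
  have hηI : etaProc W x τ ω ∈ Icc k₁ k₂ := by
    rw [hη]
    exact hbox _ _ _ ⟨hm'.trans hX0.1, hX0.2.trans hM'⟩ ⟨hd'.trans hg1.1, hg1.2⟩ ⟨hd'.trans hg2.1, hg2.2⟩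
  show ĝ (etaProc W x τ ω) = g (etaProc W x τ ω)
  exact heq hηI

/-! ### Joint continuity of the mark flows in time and path -/

/-- The recentring map `p ↦ p - p(0)` on path space is continuous. [folklore] -/
theorem continuous_recentre :
    Continuous fun p : C(ℝ≥0, ℝ) ↦ p - ContinuousMap.const ℝ≥0 (p 0) :=
  continuous_id.sub (ContinuousMap.continuous_const'.comp (continuous_eval_const (0 : ℝ≥0)))

/-- The mark flow of the recentred path is the frozen real flow of the recentred driver. [folklore] -/
theorem markFlow_drv_eq (y : ℝ) (s : ℝ≥0) (p : C(ℝ≥0, ℝ)) :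
    markFlow drv y s p = Loewner.realFlowStop (⇑(p - ContinuousMap.const ℝ≥0 (p 0))) y s := by
  have : (⇑(p - ContinuousMap.const ℝ≥0 (p 0)) : ℝ≥0 → ℝ) = fun t ↦ p t - p 0 := by
    funext t; simp
  rw [this]; rfl

/-- **Joint continuity of a mark flow in time and path**, at `(s₀, p₀)` with `p₀ 0 = 0`, when the
flow of `p₀` stays `m₀ > 0` away from the driving point on `[0, b']` and `s₀ < b'`.
[cite: Lawler2005, Ch. 4 §4.7 (Prop. 4.47)] -/
theorem continuousAt_markFlow_path {p₀ : C(ℝ≥0, ℝ)} (hp₀ : p₀ 0 = 0) {y : ℝ} {b' : ℝ≥0} {m₀ : ℝ≥0}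
    (hm₀ : 0 < m₀) (hfar : ∀ s : ℝ≥0, s ≤ b' → (m₀ : ℝ) ≤ markFlow drv y s p₀) {s₀ : ℝ≥0}
    (hs₀ : s₀ < b') :
    ContinuousAt (fun q : ℝ≥0 × C(ℝ≥0, ℝ) ↦ markFlow drv y q.1 q.2) (s₀, p₀) := by
  have hR₀ : p₀ - ContinuousMap.const ℝ≥0 (p₀ 0) = p₀ := by
    ext t; simp [hp₀]
  have hfar' : ∀ s : ℝ≥0, s ≤ b' → (m₀ : ℝ) ≤ |Loewner.realFlowStop (⇑p₀) y s| := by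
    intro s hs
    have h1 := hfar s hs
    rw [markFlow_drv_eq, hR₀] at h1
    exact h1.trans (le_abs_self _)
  have hb : ((b' : ℝ≥0) : WithTop ℝ≥0) < Loewner.swallowingTime (⇑p₀) y := by
    refine Loewner.coe_lt_swallowingTime_of_realFlowStop_ne_zero fun h0 ↦ ?_
    have h1 := hfar' b' le_rfl
    rw [h0, abs_zero] at h1
    have : (0 : ℝ) < m₀ := by exact_mod_cast hm₀
    linarith
  have hA := Loewner.continuousAt_realFlowStop_driver (w₀ := p₀) hb hm₀ hfar' hs₀
  have hcomp : ContinuousAt (fun q : ℝ≥0 × C(ℝ≥0, ℝ) ↦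
      (q.1, q.2 - ContinuousMap.const ℝ≥0 (q.2 0))) (s₀, p₀) :=
    (continuousAt_fst.prodMk (continuous_recentre.continuousAt.comp continuousAt_snd))
  have key : ContinuousAt ((fun q' : ℝ≥0 × C(ℝ≥0, ℝ) ↦ Loewner.realFlowStop (⇑q'.2) y q'.1) ∘
      (fun q : ℝ≥0 × C(ℝ≥0, ℝ) ↦ (q.1, q.2 - ContinuousMap.const ℝ≥0 (q.2 0)))) (s₀, p₀) :=
    ContinuousAt.comp_of_eq hA hcomp (by dsimp only; rw [hR₀])
  refine key.congr_of_eventuallyEq (Eventually.of_forall fun q ↦ ?_)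
  show markFlow drv y q.1 q.2 = _
  simp only [Function.comp_apply, markFlow_drv_eq]

/-- **Uniform closeness on a compact time interval from joint continuity** (compactness of
`[0, b]`): if `F` is jointly continuous at `(s, x₀)` for every `s < b'` and `b < b'`, then for every
`ε > 0`, points `x` near `x₀` satisfy `|F (s, x) - F (s, x₀)| < ε` for all `s ≤ b`. [folklore] -/
theorem eventually_forall_abs_sub_lt_of_continuousAt {X : Type*} [TopologicalSpace X]
    {F : ℝ≥0 × X → ℝ} {x₀ : X} {b b' : ℝ≥0} (hbb' : b < b')
    (hF : ∀ s : ℝ≥0, s < b' → ContinuousAt F (s, x₀)) :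
    ∀ ε : ℝ, 0 < ε → ∀ᶠ x in 𝓝 x₀, ∀ s : ℝ≥0, s ≤ b → |F (s, x) - F (s, x₀)| < ε := by
  intro ε hε
  have hP : ∀ s ∈ Icc (0 : ℝ≥0) b, ∀ᶠ z : X × ℝ≥0 in 𝓝 (x₀, s), |F (z.2, z.1) - F (z.2, x₀)| < ε := by
    intro s hs
    have hc := hF s (lt_of_le_of_lt hs.2 hbb')
    have h1 : ∀ᶠ z : ℝ≥0 × X in 𝓝 (s, x₀), dist (F z) (F (s, x₀)) < ε / 2 :=
      Metric.tendsto_nhds.1 hc (ε / 2) (half_pos hε)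
    have h2 : ∀ᶠ z : ℝ≥0 × X in 𝓝 (s, x₀), dist (F (z.1, x₀)) (F (s, x₀)) < ε / 2 := by
      have ht : Tendsto (fun z : ℝ≥0 × X ↦ (z.1, x₀)) (𝓝 (s, x₀)) (𝓝 (s, x₀)) :=
        (continuousAt_fst.prodMk continuousAt_const)
      exact ht.eventually h1
    have h3 : ∀ᶠ z : ℝ≥0 × X in 𝓝 (s, x₀), |F (z.1, z.2) - F (z.1, x₀)| < ε := by
      filter_upwards [h1, h2] with z hz1 hz2
      rw [Real.dist_eq] at hz1 hz2
      calc |F (z.1, z.2) - F (z.1, x₀)| = |(F z - F (s, x₀)) - (F (z.1, x₀) - F (s, x₀))| := by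
            congr 1; simp only [Prod.mk.eta]; ring
        _ ≤ |F z - F (s, x₀)| + |F (z.1, x₀) - F (s, x₀)| := abs_sub _ _
        _ < ε / 2 + ε / 2 := add_lt_add hz1 hz2
        _ = ε := add_halves ε
    have hsw : Tendsto (fun z : X × ℝ≥0 ↦ (z.2, z.1)) (𝓝 (x₀, s)) (𝓝 (s, x₀)) :=
      (continuous_swap.tendsto (x₀, s))
    exact hsw.eventually h3
  have hev := isCompact_Icc.eventually_forall_of_forall_eventually
    (P := fun x s ↦ |F (s, x) - F (s, x₀)| < ε) hP
  filter_upwards [hev] with x hx s hs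
  exact hx s ⟨zero_le, hs⟩

/-! ### Joint continuity of the level-stopped crossing functional at a path with clean level exits -/

/-- The flow paths of the three marks and the two gaps, as points of path space. -/
theorem continuous_gap_drv (h : AdmissibleLevels x m M d) (i j : Fin 3) (p : C(ℝ≥0, ℝ)) :
    Continuous fun s ↦ markFlow drv (x i) s p - markFlow drv (x j) s p :=
  (continuous_markFlow_drv (h.pos.trans_le (h.strictMono.monotone (Fin.zero_le i))) p).sub
    (continuous_markFlow_drv (h.pos.trans_le (h.strictMono.monotone (Fin.zero_le j))) p)

/-- **Joint continuity of the level-stopped crossing functional** at `(u₀, p₀)`, for a path `p₀`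
starting at `0` whose level time is either infinite, or finite with EVERY coordinate of the level
box that exits at the level time exiting cleanly (the first-mark flow through `m` or `M`, a gap
through `d`).  Continuous kernel, admissible data; every observation time `u₀`.
[cite: CamiaNewman2007, §5] -/
theorem continuousAt_crossingObs_path {ĝ : ℝ → ℝ} (hĝ : Continuous ĝ) (h : AdmissibleLevels x m M d)
    {p₀ : C(ℝ≥0, ℝ)} (hp₀ : p₀ 0 = 0)
    (hclean₀ : ∀ T : ℝ≥0, levelTime drv x m M d p₀ = T →
      exitTime (fun t (q : C(ℝ≥0, ℝ)) ↦ q t) m M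
        (⟨fun s ↦ markFlow drv (x 0) s p₀, continuous_markFlow_drv h.pos p₀⟩ : C(ℝ≥0, ℝ)) = T →
      ∀ ε : ℝ, 0 < ε → ∃ s : ℝ≥0, T < s ∧ (s : ℝ) < T + ε ∧
        markFlow drv (x 0) s p₀ ∉ Icc m M)
    (hclean₁ : ∀ T : ℝ≥0, levelTime drv x m M d p₀ = T →
      exitTime (fun t (q : C(ℝ≥0, ℝ)) ↦ q t) d (x 2 - x 0 + 1)
        (⟨fun s ↦ markFlow drv (x 1) s p₀ - markFlow drv (x 0) s p₀, continuous_gap_drv h 1 0 p₀⟩ :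
          C(ℝ≥0, ℝ)) = T →
      ∀ ε : ℝ, 0 < ε → ∃ s : ℝ≥0, T < s ∧ (s : ℝ) < T + ε ∧
        markFlow drv (x 1) s p₀ - markFlow drv (x 0) s p₀ ∉ Icc d (x 2 - x 0 + 1))
    (hclean₂ : ∀ T : ℝ≥0, levelTime drv x m M d p₀ = T →
      exitTime (fun t (q : C(ℝ≥0, ℝ)) ↦ q t) d (x 2 - x 0 + 1)
        (⟨fun s ↦ markFlow drv (x 2) s p₀ - markFlow drv (x 1) s p₀, continuous_gap_drv h 2 1 p₀⟩ :
          C(ℝ≥0, ℝ)) = T →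
      ∀ ε : ℝ, 0 < ε → ∃ s : ℝ≥0, T < s ∧ (s : ℝ) < T + ε ∧
        markFlow drv (x 2) s p₀ - markFlow drv (x 1) s p₀ ∉ Icc d (x 2 - x 0 + 1))
    (u₀ : ℝ≥0) :
    ContinuousAt (fun q : ℝ≥0 × C(ℝ≥0, ℝ) ↦ crossingObs ĝ drv x m M d q.1 q.2) (u₀, p₀) := by
  have hxpos : ∀ i, 0 < x i := fun i ↦ h.pos.trans_le (h.strictMono.monotone (Fin.zero_le i))
  have hmpos : (0 : ℝ) < m := h.m_pos
  -- the three coordinate paths as maps into path space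
  set Φ0 : C(ℝ≥0, ℝ) → C(ℝ≥0, ℝ) := fun p ↦
    ⟨fun s ↦ markFlow drv (x 0) s p, continuous_markFlow_drv h.pos p⟩ with hΦ0
  set Ψ1 : C(ℝ≥0, ℝ) → C(ℝ≥0, ℝ) := fun p ↦
    ⟨fun s ↦ markFlow drv (x 1) s p - markFlow drv (x 0) s p, continuous_gap_drv h 1 0 p⟩ with hΨ1
  set Ψ2 : C(ℝ≥0, ℝ) → C(ℝ≥0, ℝ) := fun p ↦
    ⟨fun s ↦ markFlow drv (x 2) s p - markFlow drv (x 1) s p, continuous_gap_drv h 2 1 p⟩ with hΨ2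
  set τ0 : C(ℝ≥0, ℝ) → WithTop ℝ≥0 := fun p ↦ exitTime (fun t (q : C(ℝ≥0, ℝ)) ↦ q t) m M (Φ0 p)
    with hτ0
  set τ1 : C(ℝ≥0, ℝ) → WithTop ℝ≥0 := fun p ↦
    exitTime (fun t (q : C(ℝ≥0, ℝ)) ↦ q t) d (x 2 - x 0 + 1) (Ψ1 p) with hτ1
  set τ2 : C(ℝ≥0, ℝ) → WithTop ℝ≥0 := fun p ↦
    exitTime (fun t (q : C(ℝ≥0, ℝ)) ↦ q t) d (x 2 - x 0 + 1) (Ψ2 p) with hτ2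
  have hlevel : ∀ p, levelTime drv x m M d p = min (τ0 p) (min (τ1 p) (τ2 p)) := fun p ↦ rfl
  set ρ₀ : WithTop ℝ≥0 := levelTime drv x m M d p₀ with hρ₀
  -- flows of `p₀` stay `≥ m` up to the level time
  have hbox : ∀ s : ℝ≥0, (s : WithTop ℝ≥0) ≤ ρ₀ → ∀ i, m ≤ markFlow drv (x i) s p₀ := by
    intro s hs i
    obtain ⟨hX0, hg1, hg2⟩ := LevelExtension.marks_mem_box (W := drv) drv_continuous drv_zero h p₀ hs
    fin_cases i
    · exact hX0.1
    · show m ≤ markFlow drv (x 1) s p₀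
      linarith [hX0.1, hg1.1, h.d_pos]
    · show m ≤ markFlow drv (x 2) s p₀
      linarith [hX0.1, hg1.1, hg2.1, h.d_pos]
  -- Step 1: horizons `b < b'` and the margin `m/2` on `[0, b']`
  obtain ⟨b, b', hbb', hTb, hub, hmar⟩ : ∃ b b' : ℝ≥0, b < b' ∧
      (∀ T : ℝ≥0, ρ₀ = T → T < b) ∧ (ρ₀ = ⊤ → u₀ < b) ∧
      ∀ i, ∀ s : ℝ≥0, s ≤ b' → m / 2 ≤ markFlow drv (x i) s p₀ := by
    induction hρ : ρ₀ with
    | top =>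
      refine ⟨u₀ + 1, u₀ + 2, by
        rw [← NNReal.coe_lt_coe]; push_cast; linarith, fun T hT ↦ absurd hT WithTop.top_ne_coe,
        fun _ ↦ by rw [← NNReal.coe_lt_coe]; push_cast; linarith, fun i s _ ↦ ?_⟩
      have := hbox s (by rw [hρ]; exact le_top) i
      linarith
    | coe T =>
      -- continuity of the three flows at `T`
      have hδ : ∀ i, ∃ δ > 0, ∀ s : ℝ≥0, dist s T < δ → m / 2 < markFlow drv (x i) s p₀ := by
        intro i
        have hc := (continuous_markFlow_drv (hxpos i) p₀).continuousAt (x := T)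
        obtain ⟨δ, hδ, hball⟩ := Metric.continuousAt_iff.1 hc (m / 2) (by positivity)
        refine ⟨δ, hδ, fun s hs ↦ ?_⟩
        have h1 := hball hs
        rw [Real.dist_eq] at h1
        have h2 := hbox T (by rw [hρ]) i
        have := (abs_sub_lt_iff.1 h1).2
        linarith
      choose δ hδpos hδ using hδ
      set δm : ℝ := min (δ 0) (min (δ 1) (δ 2)) with hδm
      have hδmpos : 0 < δm := lt_min (hδpos 0) (lt_min (hδpos 1) (hδpos 2))
      have hδle : ∀ i, δm ≤ δ i := by
        intro i; fin_cases i
        · exact min_le_left _ _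
        · exact (min_le_right _ _).trans (min_le_left _ _)
        · exact (min_le_right _ _).trans (min_le_right _ _)
      refine ⟨⟨(T : ℝ) + δm / 4, by positivity⟩, ⟨(T : ℝ) + δm / 2, by positivity⟩, ?_, ?_, ?_, ?_⟩
      · rw [← NNReal.coe_lt_coe]; show (T : ℝ) + δm / 4 < T + δm / 2; linarith
      · intro T' hT'
        have : T = T' := by exact_mod_cast hT'
        subst this
        rw [← NNReal.coe_lt_coe]; show (T : ℝ) < T + δm / 4; linarith
      · intro htop; exact absurd htop WithTop.coe_ne_top
      · intro i s hs
        have hs' : (s : ℝ) ≤ T + δm / 2 := by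
          have := NNReal.coe_le_coe.2 hs; exact this
        rcases le_or_gt s T with hsT | hTs
        · have := hbox s (by rw [hρ]; exact WithTop.coe_le_coe.2 hsT) i
          linarith
        · refine (hδ i s ?_).le
          rw [NNReal.dist_eq, abs_of_nonneg (by
            have := NNReal.coe_lt_coe.2 hTs; linarith)]
          have := NNReal.coe_lt_coe.2 hTs
          linarith [hδle i]
  -- Step 2: joint continuity of the flows on `[0, b')`
  have hm₀ : (0 : ℝ≥0) < ⟨m / 2, by positivity⟩ := by
    rw [← NNReal.coe_lt_coe]; show (0 : ℝ) < m / 2; positivity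
  have JF : ∀ i, ∀ s₀ : ℝ≥0, s₀ < b' →
      ContinuousAt (fun q : ℝ≥0 × C(ℝ≥0, ℝ) ↦ markFlow drv (x i) q.1 q.2) (s₀, p₀) :=
    fun i s₀ hs₀ ↦ continuousAt_markFlow_path hp₀ (m₀ := ⟨m / 2, by positivity⟩) hm₀
      (fun s hs ↦ hmar i s hs) hs₀
  -- Step 3: uniform closeness of the coordinate paths on `[0, b]`
  have hunif0 : ∀ ε : ℝ, 0 < ε → ∀ᶠ p in 𝓝 p₀, ∀ s : ℝ≥0, s ≤ b → |Φ0 p s - Φ0 p₀ s| < ε :=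
    eventually_forall_abs_sub_lt_of_continuousAt hbb' (F := fun q ↦ markFlow drv (x 0) q.1 q.2)
      (JF 0)
  have hunif1 : ∀ ε : ℝ, 0 < ε → ∀ᶠ p in 𝓝 p₀, ∀ s : ℝ≥0, s ≤ b → |Ψ1 p s - Ψ1 p₀ s| < ε :=
    eventually_forall_abs_sub_lt_of_continuousAt hbb'
      (F := fun q ↦ markFlow drv (x 1) q.1 q.2 - markFlow drv (x 0) q.1 q.2)
      (fun s hs ↦ (JF 1 s hs).sub (JF 0 s hs))
  have hunif2 : ∀ ε : ℝ, 0 < ε → ∀ᶠ p in 𝓝 p₀, ∀ s : ℝ≥0, s ≤ b → |Ψ2 p s - Ψ2 p₀ s| < ε :=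
    eventually_forall_abs_sub_lt_of_continuousAt hbb'
      (F := fun q ↦ markFlow drv (x 2) q.1 q.2 - markFlow drv (x 1) q.1 q.2)
      (fun s hs ↦ (JF 2 s hs).sub (JF 1 s hs))
  -- Step 4: lower semicontinuity of the level time, clean upper semicontinuity
  have hlsc : ∀ v : ℝ≥0, v ≤ b → (v : WithTop ℝ≥0) < min (τ0 p₀) (min (τ1 p₀) (τ2 p₀)) →
      ∀ᶠ p in 𝓝 p₀, (v : WithTop ℝ≥0) < min (τ0 p) (min (τ1 p) (τ2 p)) :=
    lsc_min (τ₁ := τ0) (τ₂ := fun p ↦ min (τ1 p) (τ2 p)) (x₀ := p₀) (b := b)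
      (lsc_exitTime_comp hunif0)
      (lsc_min (τ₁ := τ1) (τ₂ := τ2) (x₀ := p₀) (b := b) (lsc_exitTime_comp hunif1)
        (lsc_exitTime_comp hunif2))
  have husc : ∀ T : ℝ≥0, min (τ0 p₀) (min (τ1 p₀) (τ2 p₀)) = T → ∀ ε : ℝ, 0 < ε →
      ∃ s : ℝ≥0, (s : ℝ) < T + ε ∧ ∀ᶠ p in 𝓝 p₀, min (τ0 p) (min (τ1 p) (τ2 p)) ≤ s := by
    intro T hT
    have hρT : ρ₀ = T := by rw [hρ₀, hlevel]; exact hT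
    have hTb' : (T : WithTop ℝ≥0) < b := WithTop.coe_lt_coe.2 (hTb T hρT)
    by_cases h0 : τ0 p₀ ≤ min (τ1 p₀) (τ2 p₀)
    · have hτ0T : τ0 p₀ = T := by rw [← hT, min_eq_left h0]
      refine usc_min_left (τ₁ := τ0) (τ₂ := fun p ↦ min (τ1 p) (τ2 p)) (x₀ := p₀) h0
        (usc_exitTime_comp_of_clean hunif0 (by show τ0 p₀ < (b : WithTop ℝ≥0); rw [hτ0T]; exact hTb') ?_) T hT
      intro T' hT'
      have : T = T' := by
        have := hτ0T.symm.trans hT'; exact_mod_cast this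
      subst this
      exact hclean₀ T hρT hT'
    · have h0' : min (τ1 p₀) (τ2 p₀) ≤ τ0 p₀ := (not_le.1 h0).le
      have hmin12 : min (τ1 p₀) (τ2 p₀) = T := by rw [← hT, min_eq_right h0']
      refine usc_min_right (τ₁ := τ0) (τ₂ := fun p ↦ min (τ1 p) (τ2 p)) (x₀ := p₀) h0' ?_ T hT
      by_cases h1 : τ1 p₀ ≤ τ2 p₀
      · have hτ1T : τ1 p₀ = T := by rw [← hmin12, min_eq_left h1]
        refine usc_min_left (τ₁ := τ1) (τ₂ := τ2) (x₀ := p₀) h1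
          (usc_exitTime_comp_of_clean hunif1 (by show τ1 p₀ < (b : WithTop ℝ≥0); rw [hτ1T]; exact hTb') ?_)
        intro T' hT'
        have : T = T' := by
          have := hτ1T.symm.trans hT'; exact_mod_cast this
        subst this
        exact hclean₁ T hρT hT'
      · have h1' : τ2 p₀ ≤ τ1 p₀ := (not_le.1 h1).le
        have hτ2T : τ2 p₀ = T := by rw [← hmin12, min_eq_right h1']
        refine usc_min_right (τ₁ := τ1) (τ₂ := τ2) (x₀ := p₀) h1'
          (usc_exitTime_comp_of_clean hunif2 (by show τ2 p₀ < (b : WithTop ℝ≥0); rw [hτ2T]; exact hTb') ?_)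
        intro T' hT'
        have : T = T' := by
          have := hτ2T.symm.trans hT'; exact_mod_cast this
        subst this
        exact hclean₂ T hρT hT'
  -- Step 5: joint continuity of the stopped clock
  have CL : ContinuousAt (fun q : ℝ≥0 × C(ℝ≥0, ℝ) ↦
      (min (q.1 : WithTop ℝ≥0) (min (τ0 q.2) (min (τ1 q.2) (τ2 q.2)))).untopA) (u₀, p₀) := by
    induction hρ : ρ₀ with
    | top =>
      have hu : u₀ < b := hub hρ
      exact continuousAt_stoppedClock_of_lsc_usc (τ := fun p ↦ min (τ0 p) (min (τ1 p) (τ2 p)))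
        (x₀ := p₀) hlsc husc hu
    | coe T =>
      have hT : min (τ0 p₀) (min (τ1 p₀) (τ2 p₀)) = T := by rw [← hlevel, ← hρ₀]; exact hρ
      exact continuousAt_stoppedClock_of_lsc_usc_of_lt (τ := fun p ↦ min (τ0 p) (min (τ1 p) (τ2 p)))
        (x₀ := p₀) hlsc husc hT (hTb T hρ) u₀
  -- Step 6: the value at the clock
  set c₀ : ℝ≥0 := (min (u₀ : WithTop ℝ≥0) ρ₀).untopA with hc₀
  have hc₀ρ : (c₀ : WithTop ℝ≥0) ≤ ρ₀ := coe_untopA_min_le u₀ ρ₀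
  have hc₀b' : c₀ < b' := by
    induction hρ : ρ₀ with
    | top =>
      have h1 : c₀ ≤ u₀ := untopA_min_coe_le u₀ ρ₀
      exact lt_of_le_of_lt h1 ((hub hρ).trans hbb')
    | coe T =>
      have h1 : c₀ ≤ T := by
        rw [← WithTop.coe_le_coe, ← hρ]; exact hc₀ρ
      exact lt_of_le_of_lt h1 ((hTb T hρ).trans hbb')
  have hCLc : ContinuousAt (fun q : ℝ≥0 × C(ℝ≥0, ℝ) ↦
      ((min (q.1 : WithTop ℝ≥0) (min (τ0 q.2) (min (τ1 q.2) (τ2 q.2)))).untopA, q.2)) (u₀, p₀) :=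
    CL.prodMk continuousAt_snd
  have GF : ∀ i, ContinuousAt (fun q : ℝ≥0 × C(ℝ≥0, ℝ) ↦ markFlow drv (x i)
      (min (q.1 : WithTop ℝ≥0) (min (τ0 q.2) (min (τ1 q.2) (τ2 q.2)))).untopA q.2) (u₀, p₀) :=
    fun i ↦ ContinuousAt.comp_of_eq (JF i c₀ hc₀b') hCLc rfl
  -- denominators at the limit point
  obtain ⟨hX0, hg1, hg2⟩ := LevelExtension.marks_mem_box (W := drv) drv_continuous drv_zero h p₀ hc₀ρ
  have hpos1 : 0 < markFlow drv (x 1) c₀ p₀ := by linarith [hX0.1, hg1.1, h.d_pos]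
  have hden : markFlow drv (x 1) c₀ p₀ * (markFlow drv (x 2) c₀ p₀ - markFlow drv (x 0) c₀ p₀) ≠ 0 := by
    have : 0 < markFlow drv (x 2) c₀ p₀ - markFlow drv (x 0) c₀ p₀ := by linarith [hg1.1, hg2.1, h.d_pos]
    positivity
  have hη : ContinuousAt (fun q : ℝ≥0 × C(ℝ≥0, ℝ) ↦ etaProc drv x
      (min (q.1 : WithTop ℝ≥0) (min (τ0 q.2) (min (τ1 q.2) (τ2 q.2)))).untopA q.2) (u₀, p₀) := by
    simp only [etaProc, cardyEta]
    exact ((GF 0).mul ((GF 2).sub (GF 1))).div ((GF 1).mul ((GF 2).sub (GF 0))) hden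
  exact hĝ.continuousAt.comp hη

end Passage

end Summit.CriticalPhenomena.CardyFormulaZ2.Cruxes.CardyRigidity.CrossingMartingale

end

/-!
# Passage of the crossing-martingale property to a scaling limit (line `crossing-martingale`, crux `CardyRigidity`)

Measure-theoretic half of the PASSAGE (stub `stub_crossingMartingale`, crux `CardyRigidity`,
stmt-CriticalPhenomena-0746): from

* a limit driving process `W` (strongly measurable coordinates, continuous paths, `W 0 = 0`) on a
  probability space, and discrete driving processes `V k` converging to it in distribution on
  `C([0, ∞), ℝ)`;
* per-scale DISCRETE MARTINGALE DATA at one admissible level `(x; m, M, d)`: for `s < t`, a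
  discrete filtration, a real martingale and stopping times whose stopped values approximate the
  level-stopped crossing functional `N_u = crossingObs ĝ drv x m M d u` of the discrete driving
  path just after `s`, `t`, off small bad events (the hypothesis `hD` of
  `Loewner.integral_cylinder_eq_zero_of_discreteMartingales_of_ae_continuousAt`);
* almost sure CLEAN EXITS of the coordinates of the level box attaining the level time, for the
  limit paths (supplied at all but countably many levels by `Process.exists_countable_forall_ae_clean(_left)`),

the theorem `martingale_crossingObs_natural_of_discreteData` concludes that the level-stopped
crossing observable `crossingObs ĝ W x m M d` is a martingale in the natural filtration of `W`
(AE passage theorem ⟹ cylinder identity ⟹ monotone class,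
`Process.martingale_natural_of_integral_cylinder`).
-/

noncomputable section

open MeasureTheory Filter Set Topology
open scoped NNReal ENNReal
open Literature.Probability.RandomPlanarGeometry
open Literature.Probability.Process

namespace Summit.CriticalPhenomena.CardyFormulaZ2.Cruxes.CardyRigidity.CrossingMartingale

namespace Passage

/-- The recentred canonical driving process on path space. -/
local notation "drv" => (fun (p : C(ℝ≥0, ℝ)) (t : ℝ≥0) ↦ p t - p 0)

/-- Hitting times depend on the process only through the path at the given sample point.
[folklore] -/
theorem hittingAfter_congr_path {ι β Ω₁ Ω₂ : Type*} [Preorder ι] [InfSet ι]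
    {u₁ : ι → Ω₁ → β} {u₂ : ι → Ω₂ → β} {ω₁ : Ω₁} {ω₂ : Ω₂} (hu : ∀ j, u₁ j ω₁ = u₂ j ω₂)
    (s : Set β) (n : ι) : hittingAfter u₁ s n ω₁ = hittingAfter u₂ s n ω₂ := by
  classical
  simp only [hittingAfter, hu]

/-- Level times depend on the driving process only through the driving path. [folklore] -/
theorem levelTime_congr_path {Ω₁ Ω₂ : Type*} {W₁ : Ω₁ → ℝ≥0 → ℝ} {W₂ : Ω₂ → ℝ≥0 → ℝ}
    {ω₁ : Ω₁} {ω₂ : Ω₂} (hW : W₁ ω₁ = W₂ ω₂) (x : Fin 3 → ℝ) (m M d : ℝ) :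
    levelTime W₁ x m M d ω₁ = levelTime W₂ x m M d ω₂ := by
  have hmk : ∀ (y : ℝ) (j : ℝ≥0), markFlow W₁ y j ω₁ = markFlow W₂ y j ω₂ := by
    intro y j
    show Loewner.realFlowStop (W₁ ω₁) y j = Loewner.realFlowStop (W₂ ω₂) y j
    rw [hW]
  simp only [levelTime, exitTime]
  rw [hittingAfter_congr_path (u₁ := markFlow W₁ (x 0)) (u₂ := markFlow W₂ (x 0)) (hmk (x 0)),
    hittingAfter_congr_path (u₁ := fun t ω ↦ markFlow W₁ (x 1) t ω - markFlow W₁ (x 0) t ω)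
      (u₂ := fun t ω ↦ markFlow W₂ (x 1) t ω - markFlow W₂ (x 0) t ω) (ω₁ := ω₁) (ω₂ := ω₂)
      (fun j ↦ by simp only [hmk]),
    hittingAfter_congr_path (u₁ := fun t ω ↦ markFlow W₁ (x 2) t ω - markFlow W₁ (x 1) t ω)
      (u₂ := fun t ω ↦ markFlow W₂ (x 2) t ω - markFlow W₂ (x 1) t ω) (ω₁ := ω₁) (ω₂ := ω₂)
      (fun j ↦ by simp only [hmk])]

/-- Level-stopped crossing observables depend on the driving process only through the driving
path. [folklore] -/
theorem crossingObs_congr_path {Ω₁ Ω₂ : Type*} {W₁ : Ω₁ → ℝ≥0 → ℝ} {W₂ : Ω₂ → ℝ≥0 → ℝ}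
    {ω₁ : Ω₁} {ω₂ : Ω₂} (hW : W₁ ω₁ = W₂ ω₂) (g : ℝ → ℝ) (x : Fin 3 → ℝ) (m M d : ℝ)
    (u : ℝ≥0) : crossingObs g W₁ x m M d u ω₁ = crossingObs g W₂ x m M d u ω₂ := by
  have hmk : ∀ (y : ℝ) (j : ℝ≥0), markFlow W₁ y j ω₁ = markFlow W₂ y j ω₂ := by
    intro y j
    show Loewner.realFlowStop (W₁ ω₁) y j = Loewner.realFlowStop (W₂ ω₂) y j
    rw [hW]
  show g (etaProc W₁ x ((min (u : WithTop ℝ≥0) (levelTime W₁ x m M d ω₁)).untopA) ω₁) =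
    g (etaProc W₂ x ((min (u : WithTop ℝ≥0) (levelTime W₂ x m M d ω₂)).untopA) ω₂)
  rw [levelTime_congr_path hW]
  simp only [etaProc, hmk]

/-- The level-stopped crossing functional of the path of `W ω` is the level-stopped crossing
observable of the process `W` at `ω` (`W ω 0 = 0`). [folklore] -/
theorem crossingObs_path_eq {Ω : Type*} {W : Ω → ℝ≥0 → ℝ} (hWc : ∀ ω, Continuous (W ω))
    (hW0 : ∀ ω, W ω 0 = 0) (g : ℝ → ℝ)
    (x : Fin 3 → ℝ) (m M d : ℝ) (u : ℝ≥0) (ω : Ω) :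
    crossingObs g drv x m M d u (⟨fun r ↦ W ω r, hWc ω⟩ : C(ℝ≥0, ℝ)) =
      crossingObs g W x m M d u ω := by
  refine crossingObs_congr_path ?_ g x m M d u
  funext t
  simp [hW0 ω]

variable [MeasurableSpace C(ℝ≥0, ℝ)] [BorelSpace C(ℝ≥0, ℝ)]
  {x : Fin 3 → ℝ} {m M d : ℝ}
  {Ω : Type*} {mΩ : MeasurableSpace Ω} {μ : Measure Ω} [IsProbabilityMeasure μ]
  {W : Ω → ℝ≥0 → ℝ}
  {Ω' : ℕ → Type*} {mΩ' : ∀ k, MeasurableSpace (Ω' k)} {P : ∀ k, Measure (Ω' k)}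
  [∀ k, IsProbabilityMeasure (P k)] {V : ∀ k, ℝ≥0 → Ω' k → ℝ}

/-- **Passage of the crossing-martingale property at one level.**  See the module docstring.
[cite: CamiaNewman2007, §5] [cite: CDHKSCRAS2014, §3] -/
theorem martingale_crossingObs_natural_of_discreteData
    (hWm : ∀ t, StronglyMeasurable fun ω ↦ W ω t) (hWc : ∀ ω, Continuous (W ω))
    (hW0 : ∀ ω, W ω 0 = 0) (hVc : ∀ k ω, Continuous (V k · ω))
    (hlaw : TendstoInDistribution (fun k ω ↦ (⟨fun u ↦ V k u ω, hVc k ω⟩ : C(ℝ≥0, ℝ))) atTop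
      (fun ω ↦ (⟨fun u ↦ W ω u, hWc ω⟩ : C(ℝ≥0, ℝ))) P μ)
    {ĝ : ℝ → ℝ} (hĝ : Continuous ĝ) {B : ℝ} (hB : ∀ y, |ĝ y| ≤ B) (h : AdmissibleLevels x m M d)
    (hclean : ∀ᵐ ω ∂μ,
      (∀ T : ℝ≥0, levelTime drv x m M d (⟨fun u ↦ W ω u, hWc ω⟩ : C(ℝ≥0, ℝ)) = T →
        exitTime (fun t (q : C(ℝ≥0, ℝ)) ↦ q t) m M
          (⟨fun s ↦ markFlow drv (x 0) s (⟨fun u ↦ W ω u, hWc ω⟩ : C(ℝ≥0, ℝ)),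
            continuous_markFlow_drv h.pos _⟩ : C(ℝ≥0, ℝ)) = T →
        ∀ ε : ℝ, 0 < ε → ∃ s : ℝ≥0, T < s ∧ (s : ℝ) < T + ε ∧
          markFlow drv (x 0) s (⟨fun u ↦ W ω u, hWc ω⟩ : C(ℝ≥0, ℝ)) ∉ Icc m M) ∧
      (∀ T : ℝ≥0, levelTime drv x m M d (⟨fun u ↦ W ω u, hWc ω⟩ : C(ℝ≥0, ℝ)) = T →
        exitTime (fun t (q : C(ℝ≥0, ℝ)) ↦ q t) d (x 2 - x 0 + 1)
          (⟨fun s ↦ markFlow drv (x 1) s (⟨fun u ↦ W ω u, hWc ω⟩ : C(ℝ≥0, ℝ)) -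
              markFlow drv (x 0) s (⟨fun u ↦ W ω u, hWc ω⟩ : C(ℝ≥0, ℝ)),
            continuous_gap_drv h 1 0 _⟩ : C(ℝ≥0, ℝ)) = T →
        ∀ ε : ℝ, 0 < ε → ∃ s : ℝ≥0, T < s ∧ (s : ℝ) < T + ε ∧
          markFlow drv (x 1) s (⟨fun u ↦ W ω u, hWc ω⟩ : C(ℝ≥0, ℝ)) -
            markFlow drv (x 0) s (⟨fun u ↦ W ω u, hWc ω⟩ : C(ℝ≥0, ℝ)) ∉ Icc d (x 2 - x 0 + 1)) ∧
      (∀ T : ℝ≥0, levelTime drv x m M d (⟨fun u ↦ W ω u, hWc ω⟩ : C(ℝ≥0, ℝ)) = T →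
        exitTime (fun t (q : C(ℝ≥0, ℝ)) ↦ q t) d (x 2 - x 0 + 1)
          (⟨fun s ↦ markFlow drv (x 2) s (⟨fun u ↦ W ω u, hWc ω⟩ : C(ℝ≥0, ℝ)) -
              markFlow drv (x 1) s (⟨fun u ↦ W ω u, hWc ω⟩ : C(ℝ≥0, ℝ)),
            continuous_gap_drv h 2 1 _⟩ : C(ℝ≥0, ℝ)) = T →
        ∀ ε : ℝ, 0 < ε → ∃ s : ℝ≥0, T < s ∧ (s : ℝ) < T + ε ∧
          markFlow drv (x 2) s (⟨fun u ↦ W ω u, hWc ω⟩ : C(ℝ≥0, ℝ)) -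
            markFlow drv (x 1) s (⟨fun u ↦ W ω u, hWc ω⟩ : C(ℝ≥0, ℝ)) ∉ Icc d (x 2 - x 0 + 1)))
    (hD : ∀ s t : ℝ≥0, s < t → ∃ (C' : ℝ) (ε Δ η : ℕ → ℝ≥0),
      Tendsto ε atTop (𝓝 0) ∧ Tendsto Δ atTop (𝓝 0) ∧ Tendsto η atTop (𝓝 0) ∧
      ∀ k, ∃ (𝒢 : Filtration ℕ (mΩ' k)) (F : ℕ → Ω' k → ℝ) (σ τ : Ω' k → WithTop ℕ)
        (hσ : IsStoppingTime 𝒢 σ) (Mb : ℕ) (bad : Set (Ω' k)),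
        IsStoppingTime 𝒢 τ ∧ Martingale F 𝒢 (P k) ∧ σ ≤ τ ∧ (∀ ω, τ ω ≤ Mb) ∧
        (∀ u, u ≤ s → Measurable[hσ.measurableSpace] (V k u)) ∧
        (∀ᵐ ω ∂P k, ‖stoppedValue F σ ω‖ ≤ C') ∧ (∀ᵐ ω ∂P k, ‖stoppedValue F τ ω‖ ≤ C') ∧
        MeasurableSet bad ∧ P k bad ≤ η k ∧
        ∀ᵐ ω ∂P k, ω ∉ bad →
          (∃ u ∈ Icc s (s + Δ k), ‖stoppedValue F σ ω -
            crossingObs ĝ drv x m M d u (⟨fun r ↦ V k r ω, hVc k ω⟩ : C(ℝ≥0, ℝ))‖ ≤ ε k) ∧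
          (∃ u ∈ Icc t (t + Δ k), ‖stoppedValue F τ ω -
            crossingObs ĝ drv x m M d u (⟨fun r ↦ V k r ω, hVc k ω⟩ : C(ℝ≥0, ℝ))‖ ≤ ε k)) :
    Martingale (crossingObs ĝ W x m M d) (Filtration.natural (fun t ω ↦ W ω t) hWm) μ := by
  -- the path functional and its regularity
  set N : ℝ≥0 → C(ℝ≥0, ℝ) → ℝ := fun u p ↦ crossingObs ĝ drv x m M d u p with hN
  have hNm : ∀ u, Measurable (N u) := fun u ↦ measurable_crossingObs_path hĝ h u
  have hNu : ∀ p, Continuous fun u ↦ N u p := fun p ↦ continuous_crossingObs_time hĝ h p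
  have hNC : ∀ u p, ‖N u p‖ ≤ B := fun u p ↦ by rw [Real.norm_eq_abs]; exact hB _
  have hNae : ∀ᵐ ω ∂μ, ∀ u, ContinuousAt (Function.uncurry N)
      (u, (⟨fun r ↦ W ω r, hWc ω⟩ : C(ℝ≥0, ℝ))) := by
    filter_upwards [hclean] with ω hω u
    have h0 : (⟨fun r ↦ W ω r, hWc ω⟩ : C(ℝ≥0, ℝ)) 0 = 0 := hW0 ω
    exact continuousAt_crossingObs_path hĝ h h0 hω.1 hω.2.1 hω.2.2 u
  -- the cylinder identity for `s < t`
  have hcyl : ∀ s t : ℝ≥0, s < t → ∀ (n : ℕ) (S : Fin n → ℝ≥0), (∀ i, S i ≤ s) →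
      ∀ ψ : (Fin n → ℝ) → ℝ, Continuous ψ → (∀ v, |ψ v| ≤ 1) →
        ∫ ω, (crossingObs ĝ W x m M d t ω - crossingObs ĝ W x m M d s ω) *
          ψ (fun i ↦ W ω (S i)) ∂μ = 0 := by
    intro s t hst n S hS ψ hψc hψ1
    obtain ⟨C', ε, Δ, η, hε, hΔ, hη, hDk⟩ := hD s t hst
    have key := Loewner.integral_cylinder_eq_zero_of_discreteMartingales_of_ae_continuousAt
      (W := fun t ω ↦ W ω t) (fun ω ↦ hWc ω) hVc hlaw hNm hNu hNae hNC s t hS hψc hψ1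
      (C' := C') hε hΔ hη hDk
    simpa only [hN, crossingObs_path_eq hWc hW0] using key
  -- adaptedness and integrability in the natural filtration
  set 𝓕 := Filtration.natural (fun t ω ↦ W ω t) hWm with h𝓕
  have hWad : StronglyAdapted 𝓕 (fun t ω ↦ W ω t) := Filtration.stronglyAdapted_natural _
  have hXad : StronglyAdapted 𝓕 (crossingObs ĝ W x m M d) := by
    intro t
    have hη := FarField.stronglyMeasurable_etaProc_stopped hWad hWc hW0 h t
    exact hĝ.comp_stronglyMeasurable hη
  have hXint : ∀ t, Integrable (crossingObs ĝ W x m M d t) μ := fun t ↦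
    (integrable_const B).mono' ((hXad t).mono (𝓕.le t)).aestronglyMeasurable
      (ae_of_all _ fun ω ↦ by rw [Real.norm_eq_abs]; exact hB _)
  refine martingale_natural_of_integral_cylinder hWm hXad hXint fun s t hst n S hS ψ hψc hψ1 ↦ ?_
  rcases eq_or_lt_of_le hst with rfl | hlt
  · simp
  · exact hcyl s t hlt n S hS ψ hψc hψ1

end Passage

end Summit.CriticalPhenomena.CardyFormulaZ2.Cruxes.CardyRigidity.CrossingMartingale

end

/-!
# The crossing-martingale property of a scaling limit from discrete martingale data (line `crossing-martingale`, crux `CardyRigidity`)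

The CAPSTONE of the martingale half of stub `stub_crossingMartingale` (crux `CardyRigidity`,
stmt-CriticalPhenomena-0746): the percolation-free reduction of the crossing-martingale property
`IsCrossingMartingaleFamily g μ W 𝓕` (vocabulary of `Theorems/CardyUniqueLimitCardyRigidityDefs.lean`)
of a limit driving process `W` to

* (J) convergence in distribution, on `C([0, ∞), ℝ)`, of discrete driving processes `V k`
  (continuous paths) to the paths of `W` — Kemppainen–Smirnov for the model at hand; and
* (D) per admissible data `(x; m, M, d)` and times `s < t`, DISCRETE MARTINGALE DATA: a filtration,
  a real martingale, stopping times `σ ≤ τ ≤ Mb` whose stopped values approximate the level-stopped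
  crossing functional `crossingObs g drv x m M d u` of the discrete driving path just after `s`,
  `t`, off small bad events — for percolation: the conditional crossing probability of a fixed
  crossing event given the exploration (a Doob martingale by the domain Markov property) together
  with the convergence of slit-domain crossing probabilities (Camia–Newman 2007, §§5–7, with the
  all-rectangle hypothesis in place of Smirnov's theorem),

in the exact shapes consumed by the tree's proved passage theorems — the analogue, for level-stopped
boundary observables, of `LatticeModels.exists_observableMartingale_fkInterface_of_limitData`
(FK-Ising, interior observable with a deterministic horizon).

Proof (`isCrossingMartingaleFamily_natural_of_limitData`): clamp the kernel
(`Passage.exists_clamp_kernel`); for fixed marks `x`, the laws of the first-mark flow path and of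
the two gap paths of `W` charge only countably many levels with unclean exits
(`Process.exists_countable_forall_ae_clean`, `…_left`; a gap never exceeds its initial value,
`Loewner.realFlowStop_sub_realFlowStop_le_sub`, so gap boxes are left through the lower level);
choose monotone INNER levels avoiding these countable sets; at each of them the one-level passage
`Passage.martingale_crossingObs_natural_of_discreteData` gives a natural-filtration martingale;
`IsCrossingMartingaleFamily.of_innerLevels` extends to all admissible levels.
-/

noncomputable section

open MeasureTheory Filter Set Topology
open scoped NNReal ENNReal
open Literature.Probability.RandomPlanarGeometry
open Literature.Probability.Process

namespace Summit.CriticalPhenomena.CardyFormulaZ2.Cruxes.CardyRigidity.CrossingMartingale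

namespace Passage

/-- The recentred canonical driving process on path space. -/
local notation "drv" => (fun (p : C(ℝ≥0, ℝ)) (t : ℝ≥0) ↦ p t - p 0)

/-! ### Sequences of levels avoiding a countable set -/

/-- A nontrivial real interval is not exhausted by a countable set. [folklore] -/
theorem exists_mem_Ioo_notMem_of_countable {S : Set ℝ} (hS : S.Countable) {a a' : ℝ} (h : a < a') :
    ∃ c, c ∈ Ioo a a' ∧ c ∉ S := by
  by_contra hnot
  push Not at hnot
  have hsub : Ioo a a' ⊆ S := fun c hc ↦ hnot c hc
  have h0 : volume (Ioo a a') = 0 := measure_mono_null hsub (hS.measure_zero volume)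
  rw [Real.volume_Ioo] at h0
  have : 0 < ENNReal.ofReal (a' - a) := ENNReal.ofReal_pos.2 (by linarith)
  exact this.ne' h0

/-- **Inner approximation from above avoiding a countable set**: an antitone sequence in
`(a, a')`, off the countable `S`, converging to `a`. [folklore] -/
theorem exists_antitone_seq_notMem {S : Set ℝ} (hS : S.Countable) {a a' : ℝ} (h : a < a') :
    ∃ c : ℕ → ℝ, Antitone c ∧ (∀ n, c n ∈ Ioo a a') ∧ (∀ n, c n ∉ S) ∧ Tendsto c atTop (𝓝 a) := by
  obtain ⟨u, hu, hmem, hlim⟩ := exists_seq_strictAnti_tendsto' h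
  have hex : ∀ n, ∃ c, c ∈ Ioo (u (n + 1)) (u n) ∧ c ∉ S := fun n ↦
    exists_mem_Ioo_notMem_of_countable hS (hu (Nat.lt_succ_self n))
  choose c hc hcS using hex
  refine ⟨c, ?_, fun n ↦ ⟨(hmem (n + 1)).1.trans (hc n).1, (hc n).2.trans (hmem n).2⟩, hcS, ?_⟩
  · refine antitone_nat_of_succ_le fun n ↦ ?_
    exact ((hc (n + 1)).2.trans (hc n).1).le
  · have h1 : Tendsto (fun n ↦ u (n + 1)) atTop (𝓝 a) := hlim.comp (tendsto_add_atTop_nat 1)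
    exact tendsto_of_tendsto_of_tendsto_of_le_of_le h1 hlim (fun n ↦ (hc n).1.le)
      (fun n ↦ (hc n).2.le)

/-- **Inner approximation from below avoiding a countable set**: a monotone sequence in
`(a, a')`, off the countable `S`, converging to `a'`. [folklore] -/
theorem exists_monotone_seq_notMem {S : Set ℝ} (hS : S.Countable) {a a' : ℝ} (h : a < a') :
    ∃ c : ℕ → ℝ, Monotone c ∧ (∀ n, c n ∈ Ioo a a') ∧ (∀ n, c n ∉ S) ∧ Tendsto c atTop (𝓝 a') := by
  obtain ⟨u, hu, hmem, hlim⟩ := exists_seq_strictMono_tendsto' h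
  have hex : ∀ n, ∃ c, c ∈ Ioo (u n) (u (n + 1)) ∧ c ∉ S := fun n ↦
    exists_mem_Ioo_notMem_of_countable hS (hu (Nat.lt_succ_self n))
  choose c hc hcS using hex
  refine ⟨c, ?_, fun n ↦ ⟨(hmem n).1.trans (hc n).1, (hc n).2.trans (hmem (n + 1)).2⟩, hcS, ?_⟩
  · refine monotone_nat_of_le_succ fun n ↦ ?_
    exact ((hc n).2.trans (hc (n + 1)).1).le
  · have h1 : Tendsto (fun n ↦ u (n + 1)) atTop (𝓝 a') := hlim.comp (tendsto_add_atTop_nat 1)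
    exact tendsto_of_tendsto_of_tendsto_of_le_of_le hlim h1 (fun n ↦ (hc n).1.le)
      (fun n ↦ (hc n).2.le)

/-! ### The coordinate paths of the limit process are random elements of path space -/

section Family

variable [MeasurableSpace C(ℝ≥0, ℝ)] [BorelSpace C(ℝ≥0, ℝ)]
  {Ω : Type*} {mΩ : MeasurableSpace Ω} {μ : Measure Ω} [IsProbabilityMeasure μ]
  {W : Ω → ℝ≥0 → ℝ}
  {Ω' : ℕ → Type*} {mΩ' : ∀ k, MeasurableSpace (Ω' k)} {P : ∀ k, Measure (Ω' k)}
  [∀ k, IsProbabilityMeasure (P k)] {V : ∀ k, ℝ≥0 → Ω' k → ℝ}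

omit [MeasurableSpace C(ℝ≥0, ℝ)] [BorelSpace C(ℝ≥0, ℝ)] [IsProbabilityMeasure μ] in
/-- The mark flows of the path of `W ω` are the mark flows of `W` at `ω` (`W ω 0 = 0`).
[folklore] -/
theorem markFlow_path_eq (hWc : ∀ ω, Continuous (W ω)) (hW0 : ∀ ω, W ω 0 = 0) (y : ℝ) (s : ℝ≥0)
    (ω : Ω) : markFlow drv y s (⟨fun r ↦ W ω r, hWc ω⟩ : C(ℝ≥0, ℝ)) = markFlow W y s ω := by
  have hpath : (drv (⟨fun r ↦ W ω r, hWc ω⟩ : C(ℝ≥0, ℝ))) = W ω := by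
    funext t; simp [hW0 ω]
  show Loewner.realFlowStop (drv (⟨fun r ↦ W ω r, hWc ω⟩ : C(ℝ≥0, ℝ))) y s =
    Loewner.realFlowStop (W ω) y s
  rw [hpath]

omit [IsProbabilityMeasure μ] in
/-- A map into path space is measurable as soon as its evaluations are. [folklore] -/
theorem measurable_pathMap_of_eval {Φ : Ω → C(ℝ≥0, ℝ)} (h : ∀ r, Measurable fun ω ↦ Φ ω r) :
    Measurable Φ := by
  have := Literature.Probability.Process.measurable_continuousMap_of_eval (α := ℝ≥0) (β := ℝ) h
  rwa [← ‹BorelSpace C(ℝ≥0, ℝ)›.measurable_eq] at this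

omit [MeasurableSpace C(ℝ≥0, ℝ)] [BorelSpace C(ℝ≥0, ℝ)] [IsProbabilityMeasure μ] in
/-- The mark flows of `W` are measurable (positive marks, strongly measurable coordinates).
[folklore] -/
theorem measurable_markFlow_of_stronglyMeasurable (hWm : ∀ t, StronglyMeasurable fun ω ↦ W ω t)
    (hWc : ∀ ω, Continuous (W ω)) (hW0 : ∀ ω, W ω 0 = 0) {y : ℝ} (hy : 0 < y) (r : ℝ≥0) :
    Measurable (markFlow W y r) := by
  have hWad : StronglyAdapted (Filtration.natural (fun t ω ↦ W ω t) hWm) (fun t ω ↦ W ω t) :=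
    Filtration.stronglyAdapted_natural _
  exact (FarField.adapted_markFlow hWad hWc hW0 hy r).mono ((Filtration.natural _ hWm).le r) le_rfl

/-- **The crossing-martingale property of a scaling limit from discrete martingale data.**  See
the module docstring: (J) `V k → W` in distribution on `C([0,∞),ℝ)`, (D) discrete
martingale data approximating the level-stopped crossing functionals of the discrete driving paths
at every admissible level, for a kernel `g` continuous on `(0,1)`; then every level-stopped one-sided
crossing observable of `W` is a martingale in the natural filtration of `W`.
[cite: CamiaNewman2007, §§5–7] [cite: CDHKSCRAS2014, §3] -/
theorem isCrossingMartingaleFamily_natural_of_limitData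
    (hWm : ∀ t, StronglyMeasurable fun ω ↦ W ω t) (hWc : ∀ ω, Continuous (W ω))
    (hW0 : ∀ ω, W ω 0 = 0) (hVc : ∀ k ω, Continuous (V k · ω))
    (hlaw : TendstoInDistribution (fun k ω ↦ (⟨fun u ↦ V k u ω, hVc k ω⟩ : C(ℝ≥0, ℝ))) atTop
      (fun ω ↦ (⟨fun u ↦ W ω u, hWc ω⟩ : C(ℝ≥0, ℝ))) P μ)
    {g : ℝ → ℝ} (hg : ContinuousOn g (Ioo 0 1))
    (hD : ∀ (x : Fin 3 → ℝ) (m M d : ℝ), AdmissibleLevels x m M d → ∀ s t : ℝ≥0, s < t →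
      ∃ (C' : ℝ) (ε Δ η : ℕ → ℝ≥0),
      Tendsto ε atTop (𝓝 0) ∧ Tendsto Δ atTop (𝓝 0) ∧ Tendsto η atTop (𝓝 0) ∧
      ∀ k, ∃ (𝒢 : Filtration ℕ (mΩ' k)) (F : ℕ → Ω' k → ℝ) (σ τ : Ω' k → WithTop ℕ)
        (hσ : IsStoppingTime 𝒢 σ) (Mb : ℕ) (bad : Set (Ω' k)),
        IsStoppingTime 𝒢 τ ∧ Martingale F 𝒢 (P k) ∧ σ ≤ τ ∧ (∀ ω, τ ω ≤ Mb) ∧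
        (∀ u, u ≤ s → Measurable[hσ.measurableSpace] (V k u)) ∧
        (∀ᵐ ω ∂P k, ‖stoppedValue F σ ω‖ ≤ C') ∧ (∀ᵐ ω ∂P k, ‖stoppedValue F τ ω‖ ≤ C') ∧
        MeasurableSet bad ∧ P k bad ≤ η k ∧
        ∀ᵐ ω ∂P k, ω ∉ bad →
          (∃ u ∈ Icc s (s + Δ k), ‖stoppedValue F σ ω -
            crossingObs g drv x m M d u (⟨fun r ↦ V k r ω, hVc k ω⟩ : C(ℝ≥0, ℝ))‖ ≤ ε k) ∧
          (∃ u ∈ Icc t (t + Δ k), ‖stoppedValue F τ ω -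
            crossingObs g drv x m M d u (⟨fun r ↦ V k r ω, hVc k ω⟩ : C(ℝ≥0, ℝ))‖ ≤ ε k)) :
    IsCrossingMartingaleFamily g μ W (Filtration.natural (fun t ω ↦ W ω t) hWm) := by
  refine IsCrossingMartingaleFamily.of_innerLevels hg hWc hW0 fun x m M d h ↦ ?_
  have hxpos : ∀ i, 0 < x i := fun i ↦ h.pos.trans_le (h.strictMono.monotone (Fin.zero_le i))
  have hx01 : x 0 < x 1 := h.strictMono (by decide)
  have hx12 : x 1 < x 2 := h.strictMono (by decide)
  set G : ℝ := x 2 - x 0 + 1 with hG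
  -- Step 1: clamp the kernel
  obtain ⟨ĝ, hĝ, ⟨B, hB⟩, k₁, k₂, hĝg, hboxK⟩ := exists_clamp_kernel (x := x) hg h
  -- Step 2: the coordinate paths of `W` and their laws
  set pW : Ω → C(ℝ≥0, ℝ) := fun ω ↦ ⟨fun u ↦ W ω u, hWc ω⟩ with hpW
  set P0 : Ω → C(ℝ≥0, ℝ) := fun ω ↦
    ⟨fun s ↦ markFlow drv (x 0) s (pW ω), continuous_markFlow_drv h.pos _⟩ with hP0
  set P1 : Ω → C(ℝ≥0, ℝ) := fun ω ↦
    ⟨fun s ↦ markFlow drv (x 1) s (pW ω) - markFlow drv (x 0) s (pW ω),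
      continuous_gap_drv h 1 0 _⟩ with hP1
  set P2 : Ω → C(ℝ≥0, ℝ) := fun ω ↦
    ⟨fun s ↦ markFlow drv (x 2) s (pW ω) - markFlow drv (x 1) s (pW ω),
      continuous_gap_drv h 2 1 _⟩ with hP2
  have hmf : ∀ i (r : ℝ≥0), Measurable fun ω ↦ markFlow drv (x i) r (pW ω) := by
    intro i r
    have heq : (fun ω ↦ markFlow drv (x i) r (pW ω)) = markFlow W (x i) r :=
      funext fun ω ↦ markFlow_path_eq hWc hW0 (x i) r ω
    rw [heq]
    exact measurable_markFlow_of_stronglyMeasurable hWm hWc hW0 (hxpos i) r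
  have hP0m : Measurable P0 := measurable_pathMap_of_eval fun r ↦ hmf 0 r
  have hP1m : Measurable P1 := measurable_pathMap_of_eval fun r ↦ (hmf 1 r).sub (hmf 0 r)
  have hP2m : Measurable P2 := measurable_pathMap_of_eval fun r ↦ (hmf 2 r).sub (hmf 1 r)
  haveI : IsProbabilityMeasure (μ.map P0) := Measure.isProbabilityMeasure_map hP0m.aemeasurable
  haveI : IsProbabilityMeasure (μ.map P1) := Measure.isProbabilityMeasure_map hP1m.aemeasurable
  haveI : IsProbabilityMeasure (μ.map P2) := Measure.isProbabilityMeasure_map hP2m.aemeasurable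
  obtain ⟨A0, B0, hA0, hB0, hclean0⟩ := exists_countable_forall_ae_clean (μ.map P0)
  obtain ⟨A1, hA1, hclean1⟩ := exists_countable_forall_ae_clean_left (μ.map P1)
  obtain ⟨A2, hA2, hclean2⟩ := exists_countable_forall_ae_clean_left (μ.map P2)
  -- Step 3: inner levels avoiding the countable bad sets
  obtain ⟨mk, hmk_anti, hmk_mem, hmk_good, hmk_lim⟩ := exists_antitone_seq_notMem hA0 h.m_lt
  obtain ⟨Mk, hMk_mono, hMk_mem, hMk_good, hMk_lim⟩ := exists_monotone_seq_notMem hB0 h.lt_M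
  have hdlt : d < min (x 1 - x 0) (x 2 - x 1) := lt_min h.d_lt₁ h.d_lt₂
  obtain ⟨dk, hdk_anti, hdk_mem, hdk_good, hdk_lim⟩ :=
    exists_antitone_seq_notMem (hA1.union hA2) hdlt
  have hadm : ∀ k, AdmissibleLevels x (mk k) (Mk k) (dk k) := fun k ↦
    { strictMono := h.strictMono
      pos := h.pos
      m_pos := h.m_pos.trans (hmk_mem k).1
      m_lt := (hmk_mem k).2
      lt_M := (hMk_mem k).1
      d_pos := h.d_pos.trans (hdk_mem k).1
      d_lt₁ := (hdk_mem k).2.trans_le (min_le_left _ _)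
      d_lt₂ := (hdk_mem k).2.trans_le (min_le_right _ _) }
  refine ⟨mk, Mk, dk, hmk_anti, hMk_mono, hdk_anti, hmk_lim, hMk_lim, hdk_lim, fun k ↦
    ⟨(hmk_mem k).1.le, (hMk_mem k).2.le, (hdk_mem k).1.le, hadm k, ?_⟩⟩
  -- Step 4: the martingale at the good inner level `k`
  have hk := hadm k
  -- the observables of `ĝ` and `g` agree at the inner level
  have hEqW : crossingObs ĝ W x (mk k) (Mk k) (dk k) = crossingObs g W x (mk k) (Mk k) (dk k) := by
    funext t ω
    exact crossingObs_eq_of_clamp hĝg hboxK W hWc hW0 (hmk_mem k).1.le (hMk_mem k).2.le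
      (hdk_mem k).1.le hk t ω
  have hEqP : ∀ (u : ℝ≥0) (p : C(ℝ≥0, ℝ)),
      crossingObs ĝ drv x (mk k) (Mk k) (dk k) u p = crossingObs g drv x (mk k) (Mk k) (dk k) u p :=
    fun u p ↦ crossingObs_eq_of_clamp hĝg hboxK (fun (p : C(ℝ≥0, ℝ)) (t : ℝ≥0) ↦ p t - p 0)
      drv_continuous drv_zero (hmk_mem k).1.le (hMk_mem k).2.le (hdk_mem k).1.le hk u p
  rw [← hEqW]
  refine martingale_crossingObs_natural_of_discreteData hWm hWc hW0 hVc hlaw hĝ hB hk ?_ ?_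
  · -- a.e. clean exits at the good level
    have hc0 := ae_of_ae_map hP0m.aemeasurable (hclean0 (mk k) (hmk_good k) (Mk k) (hMk_good k))
    have hc1 := ae_of_ae_map hP1m.aemeasurable
      (hclean1 (dk k) (fun hmem ↦ hdk_good k (Or.inl hmem)) G)
    have hc2 := ae_of_ae_map hP2m.aemeasurable
      (hclean2 (dk k) (fun hmem ↦ hdk_good k (Or.inr hmem)) G)
    filter_upwards [hc0, hc1, hc2] with ω hω0 hω1 hω2
    -- initial values of the coordinate paths
    have hz : ∀ i, markFlow drv (x i) 0 (pW ω) = x i := fun i ↦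
      (LevelExtension.markFlow_continuous_and_zero (W := drv) drv_continuous drv_zero hk (pW ω) i).2
    have hstart0 : (P0 ω) 0 ∈ Ioo (mk k) (Mk k) := by
      show markFlow drv (x 0) 0 (pW ω) ∈ Ioo (mk k) (Mk k)
      rw [hz 0]; exact ⟨hk.m_lt, hk.lt_M⟩
    have hstart1 : (P1 ω) 0 ∈ Ioo (dk k) G := by
      show markFlow drv (x 1) 0 (pW ω) - markFlow drv (x 0) 0 (pW ω) ∈ Ioo (dk k) G
      rw [hz 1, hz 0]; exact ⟨hk.d_lt₁, by rw [hG]; linarith⟩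
    have hstart2 : (P2 ω) 0 ∈ Ioo (dk k) G := by
      show markFlow drv (x 2) 0 (pW ω) - markFlow drv (x 1) 0 (pW ω) ∈ Ioo (dk k) G
      rw [hz 2, hz 1]; exact ⟨hk.d_lt₂, by rw [hG]; linarith⟩
    -- a gap never exceeds its initial value before the level time: gap boxes are left through `d`
    have hpath : (drv (pW ω)) = W ω := by funext t; simp [hpW, hW0 ω]
    have hgap_le : ∀ (i j : Fin 3), i < j → ∀ (s : ℝ≥0),
        (s : WithTop ℝ≥0) ≤ levelTime drv x (mk k) (Mk k) (dk k) (pW ω) →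
        markFlow drv (x j) s (pW ω) - markFlow drv (x i) s (pW ω) ≤ x j - x i := by
      intro i j hij s hs
      obtain ⟨hX0, hg1, hg2⟩ := LevelExtension.marks_mem_box (W := drv) drv_continuous drv_zero hk
        (pW ω) hs
      have hposi : 0 < markFlow drv (x i) s (pW ω) := by
        have h0 : 0 < markFlow drv (x 0) s (pW ω) := hk.m_pos.trans_le hX0.1
        fin_cases i
        · exact h0
        · show 0 < markFlow drv (x 1) s (pW ω); linarith [hg1.1, hk.d_pos]
        · show 0 < markFlow drv (x 2) s (pW ω); linarith [hg1.1, hg2.1, hk.d_pos]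
      have halive : (s : WithTop ℝ≥0) < Loewner.swallowingTime (W ω) (x i) := by
        refine Loewner.coe_lt_swallowingTime_of_realFlowStop_ne_zero ?_
        have : markFlow drv (x i) s (pW ω) = Loewner.realFlowStop (W ω) (x i) s := by
          show Loewner.realFlowStop (drv (pW ω)) (x i) s = _; rw [hpath]
        rw [← this]; exact hposi.ne'
      have hyi : W ω 0 < x i := by rw [hW0 ω]; exact hxpos i
      have hle := Loewner.realFlowStop_sub_realFlowStop_le_sub (hWc ω) hyi (h.strictMono hij) halive
      have e1 : markFlow drv (x j) s (pW ω) = Loewner.realFlowStop (W ω) (x j) s := by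
        show Loewner.realFlowStop (drv (pW ω)) (x j) s = _; rw [hpath]
      have e2 : markFlow drv (x i) s (pW ω) = Loewner.realFlowStop (W ω) (x i) s := by
        show Loewner.realFlowStop (drv (pW ω)) (x i) s = _; rw [hpath]
      rw [e1, e2]; exact hle
    refine ⟨fun T _ hT ↦ hω0 hstart0 T hT, fun T hρ hT ↦ hω1 hstart1 T hT ?_, fun T hρ hT ↦
      hω2 hstart2 T hT ?_⟩
    · -- the first gap exits through `d` at the level time
      rcases apply_eq_or_eq_of_exitTime_eq_coe (u := fun t (q : C(ℝ≥0, ℝ)) ↦ q t) (ω := P1 ω)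
        (P1 ω).continuous hstart1 hT with h1 | h1
      · exact h1
      · exfalso
        have hle := hgap_le 0 1 (by decide) T (by rw [hρ])
        have : (P1 ω) T = markFlow drv (x 1) T (pW ω) - markFlow drv (x 0) T (pW ω) := rfl
        rw [this] at h1
        rw [h1, hG] at hle
        linarith
    · rcases apply_eq_or_eq_of_exitTime_eq_coe (u := fun t (q : C(ℝ≥0, ℝ)) ↦ q t) (ω := P2 ω)
        (P2 ω).continuous hstart2 hT with h1 | h1
      · exact h1
      · exfalso
        have hle := hgap_le 1 2 (by decide) T (by rw [hρ])
        have : (P2 ω) T = markFlow drv (x 2) T (pW ω) - markFlow drv (x 1) T (pW ω) := rfl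
        rw [this] at h1
        rw [h1, hG] at hle
        linarith
  · -- the discrete data for the clamped kernel
    intro s t hst
    obtain ⟨C', ε, Δ, η, hε, hΔ, hη, hDk⟩ := hD x (mk k) (Mk k) (dk k) hk s t hst
    refine ⟨C', ε, Δ, η, hε, hΔ, hη, fun k' ↦ ?_⟩
    obtain ⟨𝒢, F, σ, τ, hσ, Mb, bad, hτ, hF, hστ, hτM, hVm, hbσ, hbτ, hbad, hPbad, happ⟩ := hDk k'
    refine ⟨𝒢, F, σ, τ, hσ, Mb, bad, hτ, hF, hστ, hτM, hVm, hbσ, hbτ, hbad, hPbad, ?_⟩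
    filter_upwards [happ] with ω hω hωbad
    simpa only [hEqP] using hω hωbad

end Family

end Passage

end Summit.CriticalPhenomena.CardyFormulaZ2.Cruxes.CardyRigidity.CrossingMartingale

end
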